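import Summits.QuantumFields.YangMills.Theorems.UnitScaleTiltProp7SectET3Prop4
import Summits.QuantumFields.YangMills.Theorems.UnitScaleTiltProp7SectET3TransportTower
import HarnessLib

/-!
# Route `UnitScaleTilt`, crux K1 child «MinimiserStabilityRegPr» (stmt-QuantumFields-19200), stub `stub_existenceMinimalOrbit` (EX), route (α) —
# (S2)-prop4 AT THE LATTICE OF RECORD: `Prop7SectET3Prop4.exists_prop4Hyp_W80_latticeFree` (the prop4 currency of record) READ at `d = 3`, block size `F.L`,
# coarse periods `towerPeriodsT3 F n = (2L^{F.m+n})` and a successor height `N + 1` — i.e. on `Bond 3 (towerP F.L (towerPeriodsT3 F n) (N + 1))`, the codomain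
# of the chart of record `Prop7SectET3TransportTower.siteEquivTowerAt F n K (N + 1) hk` — for a `G`-valued background `U` (`B11Prop6Concrete.IsUnitaryBg U`)

Cell `ym3-torus`, width seat `ym-ust-20520-w4` (gen 2; OWNER ym3-torus-plan g25 02:32:16Z ∕ 02:38:35Z «(B) `…Prop4Tower` next»).  YM₃ on T³ is a ladder rung (R3),
NOT the Clay problem; nothing here is a claim about the stub, the crux, d = 4 or the mass gap.  `--supports stmt-QuantumFields-19200 --as helper`; count-neutral.

WHAT THIS FILE PROVES (sorry-free; no definition; [folklore] bookkeeping over `Prop7SectET3Prop4` §2).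
* `eta_mul_pow_of_height` — for a member `(F, n, K)` presented at a successor height, `n + (N + 1) = K`, the route's spacing `η := ((F.L : ℝ)⁻¹) ^ (K − n)`
  (★w2-19200 g2's `Prop7SectET3ObjectsPd` letters) satisfies the tower theorems' binder `η · L^{N+1} = 1`.
* **`exists_prop4Hyp_W80_T3tower`** — `exists_prop4Hyp_W80_latticeFree` with `d := 3`, `L := F.L`, `m := towerPeriodsT3 F n`, height `N + 1`, the block-size
  rows `1 ≤ L`, `2 ≤ L`, `3 ≤ L` (odd `L > 1`), `1 ≤ m i` DISCHARGED, and the unitarity row in the `SectEDatum` spelling `IsUnitaryBg U` (so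
  `Prop7SectET3TransportTower.isUnitaryBg_bgOfCfgTowerAt` feeds it at `U := bgOfCfgTowerAt F n K (N + 1) hk U₀`); every other row (CAR ∕ CLASS ∕ N06 ∕ ABS, see
  `Prop7SectET3Prop4`'s header) displayed VERBATIM, `η` a free letter with `η · L^{N+1} = 1`.  Conclusion:
  `Prop4Hyp (W80 ρ τc U₀ (H1LatticeCLM (L := F.L) (η := η) … φ hposπ hQ lev₁ Dc) (Cck F.L (towerPeriodsT3 F n) η (N + 1) U lev₀ lev₁ Dc levB) εC J Δπ) C₄ R′` with the
  closed-form `C₄` of §2 at `d = 3`.  Instance binders `[NeZero F.L]`, `[∀ i, NeZero (towerPeriodsT3 F n i)]` are supplied by the consumer with `haveI`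
  (`⟨…⟩` from `F.hL`, `Prop7SectET3TransportTower.towerPeriodsT3_neZero`); the fibre algebra `𝔸 : Type` (universe 0, as `B11Prop6Concrete`).
HONEST SCOPE.  Specialisation only; the CLASS rows displayed are the class-transfer face of N06(d = 3) (RULING g25-№2 §1), `b` and `M_Δ` are N06's letters.

References: T. Bałaban, CMP 102 (1985) 277–309 [Balaban1985Variational] (Prop. 4 (97)–(98) pp.292–293); CMP 99 (1985) 389–434 [Balaban1985BackgroundPropagators]
(Thm 3.11 p.416, Thm 3.12 p.423, (3.35)–(3.36) p.396); CMP 98 (1985) 17–51 [Balaban1985Averaging] (Prop. 2 p.26, Prop. 5 (157) p.42); CMP 102 (1985) 255–275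
[Balaban1985UV3] ((1)–(3) p.256).
-/

noncomputable section

open Metric Set
open scoped InnerProductSpace ComplexConjugate BigOperators

namespace Summit.QuantumFields.YangMills.Theorems.Prop7SectET3Prop4

open Literature.MathematicalPhysics.QuantumFieldTheory.Balaban1983to89
open Literature.MathematicalPhysics.QuantumFieldTheory.Balaban1983to89.T3ContinuumYM3Torus
open B11Eq103H1Complex (SiteL2K BondL2K H1LatticeCLM)
open B11Eq115Space
open B11Eq174Chart (Regime)
open B11Prop6Scheme (Prop4Hyp)
open B13Contraction113 (QuadAnalytic)
open B4Sect5Torus (TSite)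
open B4Sect5Proof (latticeConst)
open B9SectCLatticeCarrier (Bond unshift)
open B7Prop1Explicit (U1 Wcx boxVec)
open B7Prop2Explicit (pdev AvgClosed C0 c2')
open B7Prop3Flat (c3)
open B7Prop5GeneralLevels (thetaGen C3Gen)
open B9Eq310DeltaPrime (plaqHolU)
open B9Eq310HessianOperator (adTransportW)
open B9Eq315QTorus (perCfg cornerSite)
open B9Eq315QTower (towerP UlevOf)
open B9Eq326OperatorTower (QkW laplaceAk)
open B9Eq324DeltaPrimeATower (laplacePrimeAk)
open B9Eq3119DeltaPiTower (laplaceAkPi)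
open B11Eq44COperatorTower (C2T)
open B11Eq44CLetterTower (Cck)
open B11Eq80Current (W80)
open B11Eq63V0GroupCurrent (curV0)
open B11Eq98CurrentSlot (C4W)
open Summit.QuantumFields.YangMills.Theorems.Prop7SectET3TransportTower (towerPeriodsT3 one_le_towerPeriodsT3)

/-- **THE SPACING OF RECORD AT A SUCCESSOR HEIGHT**: for `n + (N + 1) = K`, `((L:ℝ)⁻¹)^{K−n} · L^{N+1} = 1` — ★w2-19200 g2's `η := ((F.L : ℝ)⁻¹) ^ (K − n)` meets
the tower theorems' `_hηL` binder at height `N + 1`. [cite: Balaban1985UV3, (1)-(3) p.256] -/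
theorem eta_mul_pow_of_height (F : T3Family) {n N K : ℕ} (hk : n + (N + 1) = K) :
    ((F.L : ℝ)⁻¹) ^ (K - n) * (F.L : ℝ) ^ (N + 1) = 1 := by
  have hL : (F.L : ℝ) ≠ 0 := by have := F.hL.2; positivity
  rw [show K - n = N + 1 by omega, inv_pow, inv_mul_cancel₀ (pow_ne_zero _ hL)]

section Tower

variable (F : T3Family) [NeZero F.L]
  {𝔸 : Type} [NormedRing 𝔸] [NormedAlgebra ℂ 𝔸] [CompleteSpace 𝔸] [NormOneClass 𝔸] [StarRing 𝔸] [NormedStarGroup 𝔸] [StarModule ℂ 𝔸]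
  {W : Type*} [NormedAddCommGroup W] [InnerProductSpace ℂ W] [FiniteDimensional ℂ W] (φ : W ≃ₗ[ℂ] 𝔸)
  {Mφ Mφ' : ℝ} (hMφ : 0 ≤ Mφ) (hMφ' : 0 ≤ Mφ') (hφ : ∀ w, ‖φ w‖ ≤ Mφ * ‖w‖) (hφ' : ∀ X, ‖φ.symm X‖ ≤ Mφ' * ‖X‖) (hstar : ∀ X : 𝔸, ‖star X‖ ≤ ‖X‖)
  {a : ℝ} (ha : 0 < a) {a' : ℝ} (ha' : 0 < a') {ϱ : ℝ} (hϱ0 : 0 ≤ ϱ) (hϱ1 : ϱ < 1)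
  (τ : 𝔸 →ₗ[ℂ] ℂ) {Cτ : ℝ} (hτ : ∀ X, ‖τ X‖ ≤ Cτ * ‖X‖) (hCτ : 0 ≤ Cτ) {Mτ : ℝ} (hτm : ∀ X Y : 𝔸, ‖τ (X * Y)‖ ≤ Mτ * ‖X‖ * ‖Y‖) (hMτ : 0 ≤ Mτ)
  {ρw : ℝ} (hρw : 0 ≤ ρw)
  (hτ₁ : ∀ X : 𝔸, τ (star X) = conj (τ X)) (hτ₂ : ∀ X Y : 𝔸, τ (X * Y) = τ (Y * X)) (hφτ : ∀ X Y : 𝔸, ⟪φ.symm X, φ.symm Y⟫_ℂ = τ (star X * Y))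
  (AQ : ℝ)

set_option maxRecDepth 8192 in
set_option maxHeartbeats 1600000 in -- §2's ≈ 80-binder statement read once more at the lattice of record
include hMφ hMφ' hφ hφ' hstar ha ha' hϱ0 hϱ1 hτ hCτ hτm hMτ hρw hτ₁ hτ₂ hφτ in
/-- **THE prop4 CURRENCY OF RECORD AT THE LATTICE OF RECORD** — `exists_prop4Hyp_W80_latticeFree` at `d = 3`, `L = F.L`, `m = towerPeriodsT3 F n`, height `N + 1`
(`Bond 3 (towerP F.L (towerPeriodsT3 F n) (N + 1))` = the codomain of `siteEquivTowerAt F n K (N + 1) hk`), `G`-valued background in the spelling `IsUnitaryBg U`;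
block-size and period rows discharged (`F.hL : Odd L ∧ 1 < L`), everything else displayed verbatim. [cite: Balaban1985Variational, Prop. 4 (97)–(98) pp.292–293; Balaban1985BackgroundPropagators, Thm 3.11 p.416, Thm 3.12 p.423; Balaban1985Averaging, Prop. 5 (157) p.42] -/
theorem exists_prop4Hyp_W80_T3tower :
    ∃ α₁ j₁ B δ : ℝ, 0 < α₁ ∧ 0 < j₁ ∧ 0 ≤ B ∧ 0 < δ ∧
      ∀ (n N : ℕ) [∀ i, NeZero (towerPeriodsT3 F n i)] (η : ℝ) (_hηL : η * (F.L : ℝ) ^ (N + 1) = 1) (c₀ c₁ : ℝ) [Fact (0 < c₀)] [Fact (0 < c₁)]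
        (_hw : c₀ * ((F.L : ℝ) ^ (N + 1)) ^ 3 = c₁) (_hρ : |η| ^ 3 / c₀ ≤ ρw)
        (U : Bond 3 (towerP F.L (towerPeriodsT3 F n) (N + 1)) → 𝔸ˣ) (hUu : B11Prop6Concrete.IsUnitaryBg U) (αU : ℕ → ℝ) (_hα0 : ∀ j, 0 ≤ αU j) (hα1 : ∀ j, αU j ≤ 1 / 64)
        (hαL : ∀ j, 50 * (((3 : ℕ) : ℝ) + 1) * αU j * (F.L : ℝ) ^ 3 ≤ 1 / 2)
        (hU1 : ∀ (j : ℕ) (x : B7Prop1Explicit.Site 3) (k : Fin 3), perCfg (towerP F.L (towerPeriodsT3 F n) (j + 1)) (UlevOf F.L (towerPeriodsT3 F n) (N + 1) U j) x k ∈ U1 𝔸)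
        (hreg : ∀ (j : ℕ) (y : TSite 3 (towerP F.L (towerPeriodsT3 F n) j)) (k : Fin 3) (ρ' : Fin 3 → Fin F.L),
          ‖((Wcx F.L (perCfg (towerP F.L (towerPeriodsT3 F n) (j + 1)) (UlevOf F.L (towerPeriodsT3 F n) (N + 1) U j)) (cornerSite F.L y) k (boxVec F.L ρ') : 𝔸ˣ) : 𝔸) - 1‖ ≤ αU j)
        (εU : ℕ → ℝ) (_hεU : ∀ j, 0 ≤ εU j) (_hUε : ∀ (j : ℕ) (b : Bond 3 (towerP F.L (towerPeriodsT3 F n) (j + 1))), ‖(UlevOf F.L (towerPeriodsT3 F n) (N + 1) U j b : 𝔸) - 1‖ ≤ εU j)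
        (_hLb : ∀ (j : ℕ) (b : Bond 3 (towerP F.L (towerPeriodsT3 F n) (j + 1))), UlevOf F.L (towerPeriodsT3 F n) (N + 1) U j b ∈ U1 𝔸)
        (α : ℝ) (_hα : 0 ≤ α) (_hαle : α ≤ α₁)
        (_hUb : ∀ b, U b ∈ U1 𝔸) (_hUη : ∀ b, ‖(U b : 𝔸) - 1‖ ≤ α * η)
        (_hpl : ∀ p : B9SectCLatticeCarrier.Plaq 3 (towerP F.L (towerPeriodsT3 F n) (N + 1)), ‖(plaqHolU U p : 𝔸) - 1‖ ≤ α * η ^ 2)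
        (_hUgrad : ∀ (x : TSite 3 (towerP F.L (towerPeriodsT3 F n) (N + 1))) (μ : Fin 3), ‖(U (x, μ) : 𝔸) - U (unshift μ x, μ)‖ ≤ α * η ^ 2)
        (_hRlev : ∀ (j : ℕ) (b : Bond 3 (towerP F.L (towerPeriodsT3 F n) (j + 1))) (w : W), ‖adTransportW φ (UlevOf F.L (towerPeriodsT3 F n) (N + 1) U j) b w‖ ≤ ‖w‖)
        (_hεg : ∀ j < N + 1, εU j ≤ α * ϱ ^ j) (_hAQ : ∑ j ∈ Finset.range (N + 1), αU j ≤ AQ)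
        (hpos' : ∀ x : SiteL2K ℂ 3 (towerP F.L (towerPeriodsT3 F n) (N + 1)) c₀ W, x ≠ 0 → 0 < RCLike.re ⟪x, laplacePrimeAk F.L (towerPeriodsT3 F n) N φ η U a' (c₁ := c₁) x⟫_ℂ)
        (hpos : ∀ x : BondL2K ℂ 3 (towerP F.L (towerPeriodsT3 F n) (N + 1)) c₀ W, x ≠ 0 →
          0 < RCLike.re ⟪x, laplaceAk F.L (towerPeriodsT3 F n) N φ η U (le_of_lt F.hL.2) αU hα1 hU1 hreg τ (c₀ := c₀) (c₁ := c₁) a x⟫_ℂ)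
        (_hc₀η : c₀ = η ^ 3) (j₀ : ℝ) (_hJ : ∀ μ y, ‖B9Eq39Adjoint.J (fun μ => B9Eq33CovDerivVector.shiftEquiv μ) (fun μ y => U (y, μ)) η μ y‖ ≤ j₀) (_hj : j₀ ≤ j₁)
        (hposπ : ∀ x : BondL2K ℂ 3 (towerP F.L (towerPeriodsT3 F n) (N + 1)) c₀ W, x ≠ 0 →
          0 < RCLike.re ⟪x, laplaceAkPi F.L (towerPeriodsT3 F n) N φ τ η U a' hpos' (le_of_lt F.hL.2) αU hα1 hU1 hreg (c₁ := c₁) a x⟫_ℂ)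
        (hQ : Function.Surjective (QkW F.L (towerPeriodsT3 F n) N φ U (le_of_lt F.hL.2) αU hα1 hU1 hreg (c₀ := c₀) (c₁ := c₁)))
        [FiniteDimensional ℂ 𝔸] (lev₀ : Bond 3 (towerP F.L (towerPeriodsT3 F n) (N + 1)) → ℕ) {κ' : Type*} [Fintype κ'] (lev₁ : κ' → ℕ)
        (Dc : (Bond 3 (towerP F.L (towerPeriodsT3 F n) (N + 1)) → 𝔸) →ₗ[ℂ] (κ' → 𝔸)) (levB : Bond 3 (towerPeriodsT3 F n) → ℕ) [Fact (0 < (F.L : ℝ))] [Fact (0 < η)]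
        -- the `C_k`-side data ([Balaban1985Averaging] Prop. 2 on `U`, the levels, the radius `ρ′` of Prop. 5's regime)
        {Gr : Subgroup 𝔸ˣ} (_hGr : AvgClosed 3 F.L Gr) (_hUG : ∀ (x : B7Prop1Explicit.Site 3) (κ : Fin 3), perCfg (towerP F.L (towerPeriodsT3 F n) (N + 1)) U x κ ∈ Gr)
        {α₀ : ℝ} (_hα₀ : 0 < α₀) (_hα3 : C0 3 * α₀ ≤ 1 / 3) (_hα4 : 4 * α₀ ≤ c2' 3 F.L)
        (_h52 : pdev (perCfg (towerP F.L (towerPeriodsT3 F n) (N + 1)) U) < α₀ * (((F.L : ℝ) ^ (N + 1))⁻¹) ^ 2) (_hlev : ∀ b, N + 1 ≤ lev₀ b) {ρ' : ℝ}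
        (_hρ' : Real.exp (4 * (800 * (((3 : ℕ) : ℝ) + 1) ^ 2 * (((3 : ℕ) : ℝ) + 4)) * α₀) * (1 + 8 * (131072 * (((3 : ℕ) : ℝ) + 1) ^ 2) * ρ') ≤ 2)
        (_hρ'4 : 4 * ρ' ≤ c3 3 F.L) (_hθ : 2 * ((3 : ℕ) : ℝ) * thetaGen 3 F.L α₀ ≤ (F.L : ℝ) ^ 3 / 16) (_hC3 : 2 * ((3 : ℕ) : ℝ) * C3Gen 3 F.L * ρ' ≤ 1)
        -- the Sect. C regime of the pair `(H̃_{1,k}, C_k)` (its `b` is the [Balaban1985BackgroundPropagators] Thm 3.12 letter) and the kernel-route window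
        {b aC εC : ℝ} (_RC : Regime (H1LatticeCLM (L := (F.L : ℝ)) (η := η) (lev₀ := lev₀) (levB := levB) φ hposπ hQ lev₁ Dc) 0
          (Cck F.L (towerPeriodsT3 F n) η (N + 1) U lev₀ lev₁ Dc levB) b 0 (C2T 3 α₀) ρ' 0 aC εC)
        (_haC : 0 < aC) (_hεa : εC + aC ≤ ρ') {ϖ : ℝ} (_hϖ0 : 0 ≤ ϖ)
        (_hϖ : ∀ bb b' : Bond 3 (towerP F.L (towerPeriodsT3 F n) (N + 1)), levWeight (F.L : ℝ) η lev₀ 3 bb / levWeight (F.L : ℝ) η lev₀ 3 b' ≤ ϖ)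
        (_hq : (εC + aC) * (Mφ * B * Mφ' * (((3 : ℕ) : ℝ) * latticeConst 3 δ)) * (C3Gen 3 F.L * (2 ^ 3 * (2 * ((3 : ℕ) : ℝ)))) ≤ 1 / 2)
        -- the W-slot's displayed letters: the V₀-group's slot, the fibre maps, the currents, the radius
        {CV RV Mρ Mτ MJ MΔ : ℝ} (_hCV : 0 ≤ CV) (_hRV : 0 < RV) (_hMρ : 0 ≤ Mρ) (_hMτ : 0 ≤ Mτ) (_hMJ : 0 ≤ MJ) (_hMΔ : 0 ≤ MΔ)
        {R' : ℝ} (_hR'0 : 0 < R') (_hR'a : R' ≤ aC) (_hR'V : R' ≤ (1 - 4 * b * C2T 3 α₀ * (εC + aC)) * RV)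
        (ρ : (𝔸 →L[ℂ] ℂ) →L[ℂ] 𝔸) (τc : 𝔸 →L[ℂ] ℂ) (U₀ : Bond 3 (towerP F.L (towerPeriodsT3 F n) (N + 1)) → 𝔸ˣ) (_hρ : ‖ρ‖ ≤ Mρ) (_hτc : ‖τc‖ ≤ Mτ)
        (_hqV : ∀ Y : Space115 (F.L : ℝ) η lev₀ lev₁ Dc, ‖Y‖ < RV → ‖curV0 (lev₁ := lev₁) (Dc := Dc) ρ τc U₀ Y‖ ≤ CV * ‖Y‖ ^ 2)
        (J : NegSize (F.L : ℝ) η lev₀ 3 𝔸) (Δπ : Space115 (F.L : ℝ) η lev₀ lev₁ Dc →L[ℂ] NegSize (F.L : ℝ) η lev₀ 3 𝔸) (_hJ : ‖J‖ ≤ MJ) (_hΔ : ‖Δπ‖ ≤ MΔ),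
        Prop4Hyp (W80 ρ τc U₀ (H1LatticeCLM (L := (F.L : ℝ)) (η := η) (lev₀ := lev₀) (levB := levB) φ hposπ hQ lev₁ Dc)
            (Cck F.L (towerPeriodsT3 F n) η (N + 1) U lev₀ lev₁ Dc levB) εC J Δπ)
          (C4W Mρ Mτ MJ MΔ b (C2T 3 α₀) (1 / (1 - 4 * b * C2T 3 α₀ * (εC + aC)))
            ((2 * (1 / (1 - 4 * b * C2T 3 α₀ * (εC + aC))) + 1) * (ϖ * (Mφ * B * Mφ' * (((3 : ℕ) : ℝ) * latticeConst 3 δ))) * (C3Gen 3 F.L * (2 ^ 3 * (2 * ((3 : ℕ) : ℝ)))) / aC)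
            (2 * (ϖ * (Mφ * B * Mφ' * (((3 : ℕ) : ℝ) * latticeConst 3 δ))) * (C3Gen 3 F.L * (2 ^ 3 * (2 * ((3 : ℕ) : ℝ)))) * (1 / (1 - 4 * b * C2T 3 α₀ * (εC + aC)))) CV R') R'  := by
  have hd : 1 ≤ 3 := by norm_num
  have hL : 1 ≤ F.L := le_of_lt F.hL.2
  have hL3 : 3 ≤ F.L := by
    obtain ⟨⟨r, hr⟩, h1⟩ := F.hL
    omega
  have hL2 : 2 ≤ F.L := le_trans (by norm_num) hL3
  obtain ⟨α₁, j₁, B, δ, hα₁, hj₁, hB, hδ, H⟩ :=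
    exists_prop4Hyp_W80_latticeFree hd F.L hL hL3 φ hMφ hMφ' hφ hφ' hstar ha ha' hϱ0 hϱ1 τ hτ hCτ hτm hMτ hρw hτ₁ hτ₂ hφτ AQ
  refine ⟨α₁, j₁, B, δ, hα₁, hj₁, hB, hδ, ?_⟩
  intro n N _ η hηL c₀ c₁ _ _ hw hρ U hUu αU hα0 hα1 hαL hU1 hreg εU hεU hUε hLb α hα hαle hUb hUη hpl hUgrad hRlev hεg hAQ hpos' hpos hc₀η j₀ hJ hj
    hposπ hQ _ lev₀ κ' _ lev₁ Dc levB _ _ Gr hGr hUG α₀ hα₀ hα3 hα4 h52 hlev ρ' hρ' hρ'4 hθ hC3 b aC εC RC haC hεa ϖ hϖ0 hϖ hq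
    CV RV Mρ Mτ MJ MΔ hCV hRV hMρ hMτ hMJ hMΔ R' hR'0 hR'a hR'V ρ τc U₀ hρn hτn hqV J Δπ hJn hΔn
  have hUst : ∀ bb, star (U bb : 𝔸) = (((U bb)⁻¹ : 𝔸ˣ) : 𝔸) := fun bb => (hUu bb).symm
  exact H N η hηL c₀ c₁ hw hρ (towerPeriodsT3 F n) (one_le_towerPeriodsT3 F n) U αU hα0 hα1 hαL hU1 hreg εU hεU hUε hLb α hα hαle hUst hUb hUη hpl
    hUgrad hRlev hεg hAQ hpos' hpos hc₀η j₀ hJ hj hposπ hQ lev₀ lev₁ Dc levB hL2 hGr hUG hα₀ hα3 hα4 h52 hlev hρ' hρ'4 hθ hC3 RC haC hεa hϖ0 hϖ hq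
    hCV hRV hMρ hMτ hMJ hMΔ hR'0 hR'a hR'V ρ τc U₀ hρn hτn hqV J Δπ hJn hΔn

end Tower

end Summit.QuantumFields.YangMills.Theorems.Prop7SectET3Prop4

end
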